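import Literature.Barriers.QuantumAdvantage.TQBFFlatStep
import Literature.Barriers.QuantumAdvantage.TQBFEmitBricks
import Literature.Computability.Complexity.StackBricksArith
import HarnessLib

/-!
# `TQBF` is `PSPACE`-hard, V: the step formula of a flat program at arbitrary block bases and its polynomial-time emitter

Arora–Barak 2009, Thm. 4.13, second half of the proof ("ψ can be computed in polynomial time"),
the part specific to the machine: the generator of the one-step formula `φ_{M,x}(C, C')` of
Claim 4.4. The generic assembly `codeFP_encode_savitchQBF` of part III (`TQBFSavitchCode.lean`)
asks for a polynomial-time generator of `encodingPropForm.encode (Φ a b)` from `(x, (a, b))`, with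
the block bases `a`, `b` in binary; for a flat presentation the step formula is
`Φ a b = ofTpl Nc (stepTpl Λ P) a b` (`TQBFFlatStep.lean`: the template on the variables
`0 … 2Nc - 1`, renamed to the blocks at `a` and `b`). This file provides

* the renamed formula in closed form — `stepTplB Λ P a b`, the step template written directly with
  block bases (`mapVars_stepTpl`: `ofTpl Nc (stepTpl Λ P) a b = stepTplB Λ P a b`, by pushing the
  renaming through the combinators: `mapVars_bigConj`, `mapVars_vecEq`, `mapVars_vecConst`), and
  likewise `accTplB` for the acceptance template (`mapVars_accTpl`);
* an explicit `FP` emitter `stepEmit P K N` on records `⟨pad, ⟨bin a, ⟨bin b, bin Wr⟩⟩⟩` — the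
  instruction level unrolled along the program (`caseInstrEmit`, `caseAtEmit`; `conjF`/`impFh`/
  `bigConjF`), every leaf a brick emitter of part IV (`TQBFEmitBricks.lean`) at a base / length
  affine in `Wr = cap · Wc` with constant coefficients (`affF`, `aAffF`, `bAffF`) — with
  **`stepEmit_apply`**: its value is `code (stepTplB Λ P a b)` whenever `Λ.H = |P|`, `1 ≤ cap` and
  `Nc ≤ |pad|`; and `accEmit`/**`accEmit_apply`** for the acceptance formula.

Part VI (`FortnowRogersOracleProofs.lean`) wraps `encodeF ∘ stepEmit ∘ (record of x, a, b)` as the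
`CodeFP` hypothesis `hΦ` of `codeFP_encode_savitchQBF` and concludes `PSPACE`-hardness.

## References

* S. Arora, B. Barak, *Computational Complexity: A Modern Approach*, CUP 2009, Thm. 4.13 (proof,
  second half: "we show how to construct … in polynomial time"), Claim 4.4 [AroraBarakCC2009].
-/

noncomputable section

namespace Literature.Barriers.QuantumAdvantage

open _root_.Computability Literature.Computability.Complexity Literature.Computability.Complexity.FlatProg Brick Plumb
  Polynomial

namespace TQBFRed

/-! ### Renaming the combinators

Maintenance note (build repair 2026-08-20; no statement changed): the four renaming lemmas
`mapVars_bigConj`, `mapVars_bitEq`, `mapVars_vecEq`, `mapVars_bitLit` are private helpers in the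
sub-namespace `TQBFRed.Emit` (opened right below), because `TQBFFlatStepCode.lean` — landed
independently — declares the same four names in `TQBFRed`, so that no module (in particular the
`Literature` root) could import both files ("environment already contains
`…TQBFRed.mapVars_bigConj`"). This file has no importers; the lemmas were only ever used here. -/

namespace Emit

/-- Renaming a conjunction list. [folklore] -/
private theorem mapVars_bigConj (f : ℕ → ℕ) (l : List (PropForm ℕ)) :
    (bigConj l).mapVars f = bigConj (l.map fun φ => φ.mapVars f) := by
  induction l with
  | nil => rfl
  | cons φ l ih => simp [bigConj, PropForm.mapVars, ih]

end Emit

/-- Renaming an implication. [folklore] -/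
@[simp] theorem mapVars_impF (f : ℕ → ℕ) (A B : PropForm ℕ) : (impF A B).mapVars f = impF (A.mapVars f) (B.mapVars f) := rfl

namespace Emit

/-- Renaming a bit equality. [folklore] -/
@[simp] private theorem mapVars_bitEq (f : ℕ → ℕ) (u v : ℕ) : (bitEq u v).mapVars f = bitEq (f u) (f v) := rfl

/-- Renaming a block equality whose blocks are translated by `f`. [folklore] -/
private theorem mapVars_vecEq {f : ℕ → ℕ} {a b a' b' n : ℕ} (h : ∀ j < n, f (a + j) = a' + j ∧ f (b + j) = b' + j) :
    (vecEq a b n).mapVars f = vecEq a' b' n := by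
  rw [vecEq, vecEq, mapVars_bigConj, List.map_map]
  congr 1
  refine List.map_congr_left fun j hj => ?_
  rw [List.mem_range] at hj
  simp [h j hj]

/-- Renaming a literal. [folklore] -/
@[simp] private theorem mapVars_bitLit (f : ℕ → ℕ) (u : ℕ) (b : Bool) : (bitLit u b).mapVars f = bitLit (f u) b := by
  cases b <;> rfl

end Emit

open Literature.Barriers.QuantumAdvantage.TQBFRed.Emit

/-- Renaming a block constant whose block is translated by `f`. [folklore] -/
theorem mapVars_vecConst {f : ℕ → ℕ} : ∀ {a a' : ℕ} {w : List Bool}, (∀ j < w.length, f (a + j) = a' + j) →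
    (vecConst a w).mapVars f = vecConst a' w
  | a, a', [], _ => rfl
  | a, a', b :: w, h => by
    simp only [vecConst, PropForm.mapVars, mapVars_bitLit]
    rw [show f a = a' by simpa using h 0 (by simp),
      mapVars_vecConst (a := a + 1) (a' := a' + 1) fun j hj => by
        have := h (j + 1) (by simpa using hj); rw [show a + 1 + j = a + (j + 1) by omega, this]; omega]

/-! ### The step template with block bases -/

section Based

variable (Λ : Lay) (P : Prog)

/-- All stacks of the block at `b` equal those of the block at `a`. [folklore] -/
def allRegsEqB (a b : ℕ) : PropForm ℕ := vecEq (b + (Λ.H + 1)) (a + (Λ.H + 1)) (Λ.K * Λ.Wr)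

/-- The stacks before stack `k` are equal. [folklore] -/
def beforeEqB (a b k : ℕ) : PropForm ℕ := vecEq (b + (Λ.H + 1)) (a + (Λ.H + 1)) (k * Λ.Wr)

/-- The stacks after stack `k` are equal. [folklore] -/
def afterEqB (a b k : ℕ) : PropForm ℕ := vecEq (b + Λ.off (k + 1) 0) (a + Λ.off (k + 1) 0) ((Λ.K - k - 1) * Λ.Wr)

/-- The constraint of one instruction, with block bases. [cite: AroraBarakCC2009, Claim 4.4] -/
def caseInstrB (a b : ℕ) : Instr → PropForm ℕ
  | .goto j => .conj (pcIs Λ b j) (allRegsEqB Λ a b)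
  | .push k s j =>
    if k < Λ.K then
      .conj (pcIs Λ b j) (.conj (beforeEqB Λ a b k) (.conj (vecConst (b + Λ.off k 0) (onehot Λ.Wc (s + 1)))
        (.conj (vecEq (b + (Λ.off k 0 + Λ.Wc)) (a + Λ.off k 0) ((Λ.cap - 1) * Λ.Wc)) (afterEqB Λ a b k))))
    else .conj (pcIs Λ b j) (allRegsEqB Λ a b)
  | .pop k t =>
    if k < Λ.K then
      .conj (beforeEqB Λ a b k) (.conj (vecEq (b + Λ.off k 0) (a + (Λ.off k 0 + Λ.Wc)) ((Λ.cap - 1) * Λ.Wc))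
        (.conj (vecConst (b + (Λ.off k 0 + (Λ.cap - 1) * Λ.Wc)) (onehot Λ.Wc 0)) (.conj (afterEqB Λ a b k)
          (bigConj ((List.range Λ.Wc).map fun v => impF (.var (a + (Λ.off k 0 + v))) (pcIs Λ b (t.getD v 0)))))))
    else .conj (pcIs Λ b (t.getD 0 0)) (allRegsEqB Λ a b)

/-- The constraint at counter value `p`, with block bases. [folklore] -/
def caseAtB (a b p : ℕ) : PropForm ℕ :=
  match P[p]? with
  | some i => caseInstrB Λ a b i
  | none => vecEq b a Λ.Nc

/-- **The step template with the `X` block at `a` and the `Y` block at `b`.**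
[cite: AroraBarakCC2009, Claim 4.4 and Thm. 4.13 (proof: φ_{M,x}(C, C'))] -/
def stepTplB (a b : ℕ) : PropForm ℕ :=
  bigConj ((List.range (Λ.H + 1)).map fun p => impF (.var (a + p)) (caseAtB Λ P a b p))

/-- The acceptance template with the block at `a`. [cite: AroraBarakCC2009, Thm. 4.13 (proof)] -/
def accTplB (k₁ acc a : ℕ) : PropForm ℕ :=
  if k₁ < Λ.K ∧ 2 ≤ Λ.cap then
    .conj (vecConst (a + Λ.off k₁ 0) (onehot Λ.Wc (acc + 1))) (vecConst (a + Λ.off k₁ 1) (onehot Λ.Wc 0))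
  else .const false

variable {Λ P}

/-- Renaming a `Y`-block leaf. [folklore] -/
theorem remap_Y (a b : ℕ) {o j : ℕ} : remap Λ.Nc a b (Λ.Nc + o + j) = b + o + j := by
  simp only [remap, show ¬ (Λ.Nc + o + j < Λ.Nc) by omega, if_false]
  omega

/-- Renaming an `X`-block leaf. [folklore] -/
theorem remap_X (a b : ℕ) {o j : ℕ} (h : o + j < Λ.Nc) : remap Λ.Nc a b (o + j) = a + o + j := by
  simp only [remap, h, if_true]
  omega

/-- Renaming `pcIs`. [folklore] -/
theorem mapVars_pcIs (a b j : ℕ) : (pcIs Λ Λ.Nc j).mapVars (remap Λ.Nc a b) = pcIs Λ b j :=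
  mapVars_vecConst fun i _ => by have := remap_Y (Λ := Λ) a b (o := 0) (j := i); simpa using this

/-- **The renamed step template in closed form**: `ofTpl Nc (stepTpl Λ P) a b = stepTplB Λ P a b`.
[cite: AroraBarakCC2009, Thm. 4.13 (proof)] -/
theorem mapVars_stepTpl (hcap : 1 ≤ Λ.cap) (a b : ℕ) : ofTpl Λ.Nc (stepTpl Λ P) a b = stepTplB Λ P a b := by
  have a3 := Wc_add_rest hcap
  have hNc : Λ.Nc = Λ.H + 1 + Λ.K * Λ.Wr := rfl
  rw [ofTpl, stepTpl, stepTplB, mapVars_bigConj, List.map_map]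
  congr 1
  refine List.map_congr_left fun p hp => ?_
  rw [List.mem_range] at hp
  rw [Function.comp_apply, mapVars_impF]
  congr 1
  · simp [PropForm.mapVars, remap, show p < Λ.Nc by omega]
  · unfold caseAt caseAtB
    -- `caseAt` (part III) and `caseAtB` match on the same instruction: case on it once for both
    cases P[p]? with
    | some i =>
      dsimp only
      cases i with
      | goto j =>
        simp only [caseInstr, caseInstrB, PropForm.mapVars, mapVars_pcIs, allRegsEq, allRegsEqB]
        rw [mapVars_vecEq fun j hj => ⟨remap_Y a b, remap_X a b (by omega)⟩]
      | push k s j =>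
        simp only [caseInstr, caseInstrB]
        split
        · rename_i hk
          have a1 := off_add_Wr (Λ := Λ) k
          have a2 := off_succ_add_after hk
          have a4 : Λ.off k 0 = Λ.H + 1 + k * Λ.Wr := Λ.off_zero k
          simp only [PropForm.mapVars, mapVars_pcIs, beforeEq, beforeEqB, afterEq, afterEqB]
          rw [mapVars_vecEq fun j hj => ⟨remap_Y a b, remap_X a b (by omega)⟩,
            mapVars_vecConst fun j hj => remap_Y a b,
            mapVars_vecEq fun j hj => ⟨remap_Y a b, remap_X a b (by omega)⟩,
            mapVars_vecEq fun j hj => ⟨remap_Y a b, remap_X a b (by omega)⟩]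
        · simp only [PropForm.mapVars, mapVars_pcIs, allRegsEq, allRegsEqB]
          rw [mapVars_vecEq fun j hj => ⟨remap_Y a b, remap_X a b (by omega)⟩]
      | pop k t =>
        simp only [caseInstr, caseInstrB]
        split
        · rename_i hk
          have a1 := off_add_Wr (Λ := Λ) k
          have a2 := off_succ_add_after hk
          have a4 : Λ.off k 0 = Λ.H + 1 + k * Λ.Wr := Λ.off_zero k
          simp only [PropForm.mapVars, beforeEq, beforeEqB, afterEq, afterEqB, mapVars_bigConj, List.map_map]
          rw [mapVars_vecEq fun j hj => ⟨remap_Y a b, remap_X a b (by omega)⟩,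
            mapVars_vecEq fun j hj => ⟨remap_Y a b, remap_X a b (by omega)⟩,
            mapVars_vecConst fun j hj => remap_Y a b,
            mapVars_vecEq fun j hj => ⟨remap_Y a b, remap_X a b (by omega)⟩]
          congr 5
          refine List.map_congr_left fun v hv => ?_
          rw [List.mem_range] at hv
          rw [Function.comp_apply, mapVars_impF, mapVars_pcIs]
          simp only [PropForm.mapVars]
          rw [remap_X a b (by omega), Nat.add_assoc]
        · simp only [PropForm.mapVars, mapVars_pcIs, allRegsEq, allRegsEqB]
          rw [mapVars_vecEq fun j hj => ⟨remap_Y a b, remap_X a b (by omega)⟩]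
    | none =>
      dsimp only
      have := mapVars_vecEq (f := remap Λ.Nc a b) (a := Λ.Nc) (b := 0) (a' := b) (b' := a) (n := Λ.Nc) fun j hj =>
        ⟨by have := remap_Y (Λ := Λ) a b (o := 0) (j := j); simpa using this,
          by have := remap_X (Λ := Λ) a b (o := 0) (j := j) (by simpa using hj); simpa using this⟩
      exact this

/-- **The renamed acceptance template in closed form.** [folklore] -/
theorem mapVars_accTpl (k₁ acc a : ℕ) : ofTpl₁ (accTpl Λ k₁ acc) a = accTplB Λ k₁ acc a := by
  unfold ofTpl₁ accTpl accTplB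
  split
  · simp only [PropForm.mapVars]
    rw [mapVars_vecConst (a' := a + Λ.off k₁ 0) fun j _ => (Nat.add_assoc _ _ _).symm,
      mapVars_vecConst (a' := a + Λ.off k₁ 1) fun j _ => (Nat.add_assoc _ _ _).symm]
  · rfl

end Based

/-! ### Meta-level combinators of emitters -/

/-- Emitter of a conjunction from emitters of the conjuncts. [folklore] -/
def conjF (e₁ e₂ : List Bool → List Bool) : List Bool → List Bool := fun z => (fun _ => [true, true, false]) z ++ (e₁ z ++ e₂ z)

/-- `conjF e₁ e₂ ∈ FP`. [folklore] -/
theorem conjF_mem_FP {e₁ e₂ : List Bool → List Bool} (h₁ : e₁ ∈ FP) (h₂ : e₂ ∈ FP) : conjF e₁ e₂ ∈ FP :=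
  append_mem_FP (const_mem_FP _) (append_mem_FP h₁ h₂)

/-- Value of `conjF`. [folklore] -/
theorem conjF_apply {e₁ e₂ : List Bool → List Bool} {z : List Bool} {A B : PropForm ℕ} (h₁ : e₁ z = A.code) (h₂ : e₂ z = B.code) :
    conjF e₁ e₂ z = (PropForm.conj A B).code := by
  simp [conjF, h₁, h₂, PropForm.code]

/-- Emitter of an implication from emitters of its parts. [folklore] -/
def impFh (e₁ e₂ : List Bool → List Bool) : List Bool → List Bool := fun z => (fun _ => [true, true, true, true, false]) z ++ (e₁ z ++ e₂ z)

/-- `impFh e₁ e₂ ∈ FP`. [folklore] -/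
theorem impFh_mem_FP {e₁ e₂ : List Bool → List Bool} (h₁ : e₁ ∈ FP) (h₂ : e₂ ∈ FP) : impFh e₁ e₂ ∈ FP :=
  append_mem_FP (const_mem_FP _) (append_mem_FP h₁ h₂)

/-- Value of `impFh`. [folklore] -/
theorem impFh_apply {e₁ e₂ : List Bool → List Bool} {z : List Bool} {A B : PropForm ℕ} (h₁ : e₁ z = A.code) (h₂ : e₂ z = B.code) :
    impFh e₁ e₂ z = (impF A B).code := by
  simp [impFh, h₁, h₂, code_impF]

/-- Emitter of a conjunction list from a list of emitters. [folklore] -/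
def bigConjF : List (List Bool → List Bool) → (List Bool → List Bool)
  | [] => fun _ => [false, true, true]
  | e :: es => fun z => (fun _ => [true, true, false]) z ++ (e z ++ bigConjF es z)

/-- `bigConjF es ∈ FP`. [folklore] -/
theorem bigConjF_mem_FP : ∀ {es : List (List Bool → List Bool)}, (∀ e ∈ es, e ∈ FP) → bigConjF es ∈ FP
  | [], _ => const_mem_FP _
  | e :: es, h => append_mem_FP (const_mem_FP _) (append_mem_FP (h e (by simp)) (bigConjF_mem_FP fun e' he' => h e' (by simp [he'])))

/-- Value of `bigConjF` on mapped lists. [folklore] -/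
theorem bigConjF_map_apply {ι : Type} {e : ι → (List Bool → List Bool)} {φ : ι → PropForm ℕ} {z : List Bool} :
    ∀ {l : List ι}, (∀ i ∈ l, e i z = (φ i).code) → bigConjF (l.map e) z = (bigConj (l.map φ)).code
  | [], _ => rfl
  | i :: l, h => by
    have ih := bigConjF_map_apply (l := l) fun i' hi' => h i' (by simp [hi'])
    simp only [List.map_cons, bigConjF, bigConj, PropForm.code, h i (by simp), ih]
    simp

/-! ### Numerals read off the record `⟨pad, ⟨bin a, ⟨bin b, bin Wr⟩⟩⟩` -/

section Record

variable (Wc : ℕ)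

/-- `bin (c₀ + c₁ · Wr)`. [folklore] -/
def affF (c₀ c₁ : ℕ) : List Bool → List Bool :=
  addFn ∘ fanoutFn (fun _ => encodeNat c₀) (prodFn ∘ fanoutFn (fun _ => encodeNat c₁) (sndPow 2))

/-- `bin (a + c₀ + c₁ · Wr)`. [folklore] -/
def aAffF (c₀ c₁ : ℕ) : List Bool → List Bool := addFn ∘ fanoutFn (nthF 1) (affF c₀ c₁)

/-- `bin (b + c₀ + c₁ · Wr)`. [folklore] -/
def bAffF (c₀ c₁ : ℕ) : List Bool → List Bool := addFn ∘ fanoutFn (nthF 2) (affF c₀ c₁)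

/-- `bin (b + c₀ + c₁ · Wr - Wc)`. [folklore] -/
def bAffSubF (c₀ c₁ : ℕ) : List Bool → List Bool := subFn ∘ fanoutFn (bAffF c₀ c₁) (fun _ => encodeNat Wc)

/-- `bin (Wr - Wc)`. [folklore] -/
def wrSubF : List Bool → List Bool := subFn ∘ fanoutFn (sndPow 2) (fun _ => encodeNat Wc)

/-- `affF c₀ c₁ ∈ FP`. [folklore] -/
theorem affF_mem_FP (c₀ c₁ : ℕ) : affF c₀ c₁ ∈ FP :=
  comp_mem_FP addFn_mem_FP (fanoutFn_mem_FP (const_mem_FP _) (comp_mem_FP prodFn_mem_FP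
    (fanoutFn_mem_FP (const_mem_FP _) (sndPow_mem_FP 2))))

/-- `aAffF c₀ c₁ ∈ FP`. [folklore] -/
theorem aAffF_mem_FP (c₀ c₁ : ℕ) : aAffF c₀ c₁ ∈ FP := comp_mem_FP addFn_mem_FP (fanoutFn_mem_FP (nthF_mem_FP 1) (affF_mem_FP c₀ c₁))

/-- `bAffF c₀ c₁ ∈ FP`. [folklore] -/
theorem bAffF_mem_FP (c₀ c₁ : ℕ) : bAffF c₀ c₁ ∈ FP := comp_mem_FP addFn_mem_FP (fanoutFn_mem_FP (nthF_mem_FP 2) (affF_mem_FP c₀ c₁))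

/-- `bAffSubF Wc c₀ c₁ ∈ FP`. [folklore] -/
theorem bAffSubF_mem_FP (c₀ c₁ : ℕ) : bAffSubF Wc c₀ c₁ ∈ FP :=
  comp_mem_FP subFn_mem_FP (fanoutFn_mem_FP (bAffF_mem_FP c₀ c₁) (const_mem_FP _))

/-- `wrSubF Wc ∈ FP`. [folklore] -/
theorem wrSubF_mem_FP : wrSubF Wc ∈ FP := comp_mem_FP subFn_mem_FP (fanoutFn_mem_FP (sndPow_mem_FP 2) (const_mem_FP _))

variable (pad : List Bool) (a b Wr : ℕ)

/-- The record. [folklore] -/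
def rec4 : List Bool := boolPair pad (boolPair (encodeNat a) (boolPair (encodeNat b) (encodeNat Wr)))

/-- Field `0`. [folklore] -/
@[simp] theorem nthF0_rec4 : nthF 0 (rec4 pad a b Wr) = pad := by simp [rec4]
/-- Field `1`. [folklore] -/
@[simp] theorem nthF1_rec4 : nthF 1 (rec4 pad a b Wr) = encodeNat a := by simp [rec4]
/-- Field `2`. [folklore] -/
@[simp] theorem nthF2_rec4 : nthF 2 (rec4 pad a b Wr) = encodeNat b := by simp [rec4, nthF]
/-- Field `3`. [folklore] -/
@[simp] theorem sndPow2_rec4 : sndPow 2 (rec4 pad a b Wr) = encodeNat Wr := by simp [rec4, sndPow]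

/-- Value of `affF`. [folklore] -/
@[simp] theorem affF_rec4 (c₀ c₁ : ℕ) : affF c₀ c₁ (rec4 pad a b Wr) = encodeNat (c₀ + c₁ * Wr) := by
  simp [affF]
/-- Value of `aAffF`. [folklore] -/
@[simp] theorem aAffF_rec4 (c₀ c₁ : ℕ) : aAffF c₀ c₁ (rec4 pad a b Wr) = encodeNat (a + (c₀ + c₁ * Wr)) := by
  simp [aAffF]
/-- Value of `bAffF`. [folklore] -/
@[simp] theorem bAffF_rec4 (c₀ c₁ : ℕ) : bAffF c₀ c₁ (rec4 pad a b Wr) = encodeNat (b + (c₀ + c₁ * Wr)) := by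
  simp [bAffF]
/-- Value of `bAffSubF`. [folklore] -/
@[simp] theorem bAffSubF_rec4 (c₀ c₁ : ℕ) : bAffSubF Wc c₀ c₁ (rec4 pad a b Wr) = encodeNat (b + (c₀ + c₁ * Wr) - Wc) := by
  simp [bAffSubF]
/-- Value of `wrSubF`. [folklore] -/
@[simp] theorem wrSubF_rec4 : wrSubF Wc (rec4 pad a b Wr) = encodeNat (Wr - Wc) := by
  simp [wrSubF]

end Record

/-! ### Leaf emitters on the record -/

/-- A block-equality leaf: bases and length computed by `e₁, e₂, e₃`. [folklore] -/
def vecEqLeaf (e₁ e₂ e₃ : List Bool → List Bool) : List Bool → List Bool :=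
  vecEqF ∘ fanoutFn (fanoutFn (nthF 0) (fanoutFn e₁ e₂)) e₃

/-- `vecEqLeaf e₁ e₂ e₃ ∈ FP`. [folklore] -/
theorem vecEqLeaf_mem_FP {e₁ e₂ e₃ : List Bool → List Bool} (h₁ : e₁ ∈ FP) (h₂ : e₂ ∈ FP) (h₃ : e₃ ∈ FP) : vecEqLeaf e₁ e₂ e₃ ∈ FP :=
  comp_mem_FP vecEqF_mem_FP (fanoutFn_mem_FP (fanoutFn_mem_FP (nthF_mem_FP 0) (fanoutFn_mem_FP h₁ h₂)) h₃)

/-- Value of a block-equality leaf. [folklore] -/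
theorem vecEqLeaf_apply {e₁ e₂ e₃ : List Bool → List Bool} {z pad : List Bool} {u v m : ℕ} (h₀ : nthF 0 z = pad)
    (h₁ : e₁ z = encodeNat u) (h₂ : e₂ z = encodeNat v) (h₃ : e₃ z = encodeNat m) (hm : m ≤ pad.length) :
    vecEqLeaf e₁ e₂ e₃ z = (vecEq u v m).code := by
  simp only [vecEqLeaf, Function.comp_apply, fanoutFn_apply, h₀, h₁, h₂, h₃]
  exact vecEqF_apply pad u v hm

/-- A block-constant leaf with a fixed word `w`: base computed by `e`. [folklore] -/
def vecConstLeaf (w : List Bool) (e : List Bool → List Bool) : List Bool → List Bool := vecConstCF w ∘ e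

/-- `vecConstLeaf w e ∈ FP`. [folklore] -/
theorem vecConstLeaf_mem_FP (w : List Bool) {e : List Bool → List Bool} (h : e ∈ FP) : vecConstLeaf w e ∈ FP :=
  comp_mem_FP (vecConstCF_mem_FP w) h

/-- Value of a block-constant leaf. [folklore] -/
theorem vecConstLeaf_apply (w : List Bool) {e : List Bool → List Bool} {z : List Bool} {u : ℕ} (h : e z = encodeNat u) :
    vecConstLeaf w e z = (vecConst u w).code := by
  rw [vecConstLeaf, Function.comp_apply, h, vecConstCF_encodeNat]

/-- A variable leaf: index computed by `e`. [folklore] -/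
def varLeaf (e : List Bool → List Bool) : List Bool → List Bool := varCodeF ∘ e

/-- `varLeaf e ∈ FP`. [folklore] -/
theorem varLeaf_mem_FP {e : List Bool → List Bool} (h : e ∈ FP) : varLeaf e ∈ FP := comp_mem_FP varCodeF_mem_FP h

/-- Value of a variable leaf. [folklore] -/
theorem varLeaf_apply {e : List Bool → List Bool} {z : List Bool} {u : ℕ} (h : e z = encodeNat u) :
    varLeaf e z = (PropForm.var u).code := by
  rw [varLeaf, Function.comp_apply, h, varCodeF_encodeNat]

/-! ### The step emitter -/

section StepEmit

variable (P : Prog) (K N : ℕ)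

/-- The emitter of one instruction's constraint (unrolled along the static structure).
[cite: AroraBarakCC2009, Thm. 4.13 (proof: "in polynomial time")] -/
def caseInstrEmit : Instr → (List Bool → List Bool)
  | .goto j => conjF (vecConstLeaf (onehot (P.length + 1) j) (nthF 2)) (vecEqLeaf (bAffF (P.length + 1) 0) (aAffF (P.length + 1) 0) (affF 0 K))
  | .push k s j =>
    if k < K then
      conjF (vecConstLeaf (onehot (P.length + 1) j) (nthF 2))
        (conjF (vecEqLeaf (bAffF (P.length + 1) 0) (aAffF (P.length + 1) 0) (affF 0 k))
          (conjF (vecConstLeaf (onehot (N + 2) (s + 1)) (bAffF (P.length + 1) k))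
            (conjF (vecEqLeaf (bAffF (P.length + 1 + (N + 2)) k) (aAffF (P.length + 1) k) (wrSubF (N + 2)))
              (vecEqLeaf (bAffF (P.length + 1) (k + 1)) (aAffF (P.length + 1) (k + 1)) (affF 0 (K - k - 1))))))
    else conjF (vecConstLeaf (onehot (P.length + 1) j) (nthF 2)) (vecEqLeaf (bAffF (P.length + 1) 0) (aAffF (P.length + 1) 0) (affF 0 K))
  | .pop k t =>
    if k < K then
      conjF (vecEqLeaf (bAffF (P.length + 1) 0) (aAffF (P.length + 1) 0) (affF 0 k))
        (conjF (vecEqLeaf (bAffF (P.length + 1) k) (aAffF (P.length + 1 + (N + 2)) k) (wrSubF (N + 2)))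
          (conjF (vecConstLeaf (onehot (N + 2) 0) (bAffSubF (N + 2) (P.length + 1) (k + 1)))
            (conjF (vecEqLeaf (bAffF (P.length + 1) (k + 1)) (aAffF (P.length + 1) (k + 1)) (affF 0 (K - k - 1)))
              (bigConjF ((List.range (N + 2)).map fun v =>
                impFh (varLeaf (aAffF (P.length + 1 + v) k)) (vecConstLeaf (onehot (P.length + 1) (t.getD v 0)) (nthF 2)))))))
    else conjF (vecConstLeaf (onehot (P.length + 1) (t.getD 0 0)) (nthF 2))
      (vecEqLeaf (bAffF (P.length + 1) 0) (aAffF (P.length + 1) 0) (affF 0 K))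

/-- The emitter of the constraint at counter value `p`. [folklore] -/
def caseAtEmit (p : ℕ) : List Bool → List Bool :=
  match P[p]? with
  | some i => caseInstrEmit P K N i
  | none => vecEqLeaf (nthF 2) (nthF 1) (affF (P.length + 1) K)

/-- **The emitter of the step formula** `stepTplB Λ P a b`, on the record `⟨pad, ⟨bin a, ⟨bin b, bin Wr⟩⟩⟩`.
[cite: AroraBarakCC2009, Thm. 4.13 (proof: "we show how to construct … in polynomial time")] -/
def stepEmit : List Bool → List Bool :=
  bigConjF ((List.range (P.length + 1)).map fun p => impFh (varLeaf (aAffF p 0)) (caseAtEmit P K N p))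

variable {P K N}

/-- `caseInstrEmit P K N i ∈ FP`. [folklore] -/
theorem caseInstrEmit_mem_FP (i : Instr) : caseInstrEmit P K N i ∈ FP := by
  cases i with
  | goto j =>
    exact conjF_mem_FP (vecConstLeaf_mem_FP _ (nthF_mem_FP 2))
      (vecEqLeaf_mem_FP (bAffF_mem_FP _ _) (aAffF_mem_FP _ _) (affF_mem_FP _ _))
  | push k s j =>
    simp only [caseInstrEmit]
    split
    · exact conjF_mem_FP (vecConstLeaf_mem_FP _ (nthF_mem_FP 2)) (conjF_mem_FP
        (vecEqLeaf_mem_FP (bAffF_mem_FP _ _) (aAffF_mem_FP _ _) (affF_mem_FP _ _)) (conjF_mem_FP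
          (vecConstLeaf_mem_FP _ (bAffF_mem_FP _ _)) (conjF_mem_FP
            (vecEqLeaf_mem_FP (bAffF_mem_FP _ _) (aAffF_mem_FP _ _) (wrSubF_mem_FP _))
            (vecEqLeaf_mem_FP (bAffF_mem_FP _ _) (aAffF_mem_FP _ _) (affF_mem_FP _ _)))))
    · exact conjF_mem_FP (vecConstLeaf_mem_FP _ (nthF_mem_FP 2))
        (vecEqLeaf_mem_FP (bAffF_mem_FP _ _) (aAffF_mem_FP _ _) (affF_mem_FP _ _))
  | pop k t =>
    simp only [caseInstrEmit]
    split
    · exact conjF_mem_FP (vecEqLeaf_mem_FP (bAffF_mem_FP _ _) (aAffF_mem_FP _ _) (affF_mem_FP _ _)) (conjF_mem_FP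
        (vecEqLeaf_mem_FP (bAffF_mem_FP _ _) (aAffF_mem_FP _ _) (wrSubF_mem_FP _)) (conjF_mem_FP
          (vecConstLeaf_mem_FP _ (bAffSubF_mem_FP _ _ _)) (conjF_mem_FP
            (vecEqLeaf_mem_FP (bAffF_mem_FP _ _) (aAffF_mem_FP _ _) (affF_mem_FP _ _))
            (bigConjF_mem_FP fun e he => by
              simp only [List.mem_map, List.mem_range] at he
              obtain ⟨v, -, rfl⟩ := he
              exact impFh_mem_FP (varLeaf_mem_FP (aAffF_mem_FP _ _)) (vecConstLeaf_mem_FP _ (nthF_mem_FP 2))))))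
    · exact conjF_mem_FP (vecConstLeaf_mem_FP _ (nthF_mem_FP 2))
        (vecEqLeaf_mem_FP (bAffF_mem_FP _ _) (aAffF_mem_FP _ _) (affF_mem_FP _ _))

/-- `caseAtEmit P K N p ∈ FP`. [folklore] -/
theorem caseAtEmit_mem_FP (p : ℕ) : caseAtEmit P K N p ∈ FP := by
  unfold caseAtEmit
  split
  · exact caseInstrEmit_mem_FP _
  · exact vecEqLeaf_mem_FP (nthF_mem_FP 2) (nthF_mem_FP 1) (affF_mem_FP _ _)

/-- **`stepEmit P K N ∈ FP`.** [cite: AroraBarakCC2009, Thm. 4.13 (proof), §1.3] -/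
theorem stepEmit_mem_FP : stepEmit P K N ∈ FP :=
  bigConjF_mem_FP fun e he => by
    simp only [List.mem_map, List.mem_range] at he
    obtain ⟨p, -, rfl⟩ := he
    exact impFh_mem_FP (varLeaf_mem_FP (aAffF_mem_FP _ _)) (caseAtEmit_mem_FP p)

end StepEmit

/-! ### Value of the step emitter -/

section StepEmitApply

variable {Λ : Lay} {P : Prog} (hH : Λ.H = P.length) (hcap : 1 ≤ Λ.cap) (pad : List Bool) (a b : ℕ)
  (hpad : Λ.Nc ≤ pad.length)
include hH hcap hpad

/-- **Value of one instruction's emitter.** [cite: AroraBarakCC2009, Thm. 4.13 (proof)] -/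
theorem caseInstrEmit_apply (i : Instr) :
    caseInstrEmit P Λ.K Λ.N i (rec4 pad a b Λ.Wr) = (caseInstrB Λ a b i).code := by
  have a3 := Wc_add_rest (Λ := Λ) hcap
  have hNc : Λ.Nc = Λ.H + 1 + Λ.K * Λ.Wr := rfl
  have hWc : Λ.Wc = Λ.N + 2 := rfl
  have hKWr : ∀ {k}, k < Λ.K → (k + 1) * Λ.Wr ≤ Λ.K * Λ.Wr := fun hk => Nat.mul_le_mul_right _ hk
  -- the all-stacks leaf
  have hall : vecEqLeaf (bAffF (P.length + 1) 0) (aAffF (P.length + 1) 0) (affF 0 Λ.K) (rec4 pad a b Λ.Wr) =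
      (allRegsEqB Λ a b).code := by
    rw [vecEqLeaf_apply (nthF0_rec4 _ _ _ _) (bAffF_rec4 _ _ _ _ _ _) (aAffF_rec4 _ _ _ _ _ _) (affF_rec4 _ _ _ _ _ _)
      (by omega), allRegsEqB]
    congr 2 <;> simp [hH]
  have hpc : ∀ j, vecConstLeaf (onehot (P.length + 1) j) (nthF 2) (rec4 pad a b Λ.Wr) = (pcIs Λ b j).code := fun j => by
    rw [vecConstLeaf_apply _ (nthF2_rec4 _ _ _ _), pcIs, hH]
  cases i with
  | goto j => exact conjF_apply (hpc j) hall
  | push k s j =>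
    simp only [caseInstrEmit, caseInstrB]
    by_cases hk : k < Λ.K
    · rw [if_pos hk, if_pos hk]
      have a1 := off_add_Wr (Λ := Λ) k
      have a2 := off_succ_add_after (Λ := Λ) hk
      have a4 : Λ.off k 0 = Λ.H + 1 + k * Λ.Wr := Λ.off_zero k
      have a5 : Λ.off (k + 1) 0 = Λ.H + 1 + (k + 1) * Λ.Wr := Λ.off_zero (k + 1)
      have hk' := hKWr hk
      refine conjF_apply (hpc j) (conjF_apply ?_ (conjF_apply ?_ (conjF_apply ?_ ?_)))
      · rw [vecEqLeaf_apply (nthF0_rec4 _ _ _ _) (bAffF_rec4 _ _ _ _ _ _) (aAffF_rec4 _ _ _ _ _ _) (affF_rec4 _ _ _ _ _ _)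
          (by nlinarith), beforeEqB]
        congr 2 <;> simp [hH]
      · rw [vecConstLeaf_apply _ (bAffF_rec4 _ _ _ _ _ _), a4, hH, hWc]
      · rw [vecEqLeaf_apply (nthF0_rec4 _ _ _ _) (bAffF_rec4 _ _ _ _ _ _) (aAffF_rec4 _ _ _ _ _ _) (wrSubF_rec4 _ _ _ _ _)
          (by omega)]
        congr 2 <;> omega
      · rw [vecEqLeaf_apply (nthF0_rec4 _ _ _ _) (bAffF_rec4 _ _ _ _ _ _) (aAffF_rec4 _ _ _ _ _ _) (affF_rec4 _ _ _ _ _ _)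
          (by nlinarith), afterEqB, a5]
        congr 2 <;> simp [hH]
    · rw [if_neg hk, if_neg hk]
      exact conjF_apply (hpc j) hall
  | pop k t =>
    simp only [caseInstrEmit, caseInstrB]
    by_cases hk : k < Λ.K
    · rw [if_pos hk, if_pos hk]
      have a1 := off_add_Wr (Λ := Λ) k
      have a2 := off_succ_add_after (Λ := Λ) hk
      have a4 : Λ.off k 0 = Λ.H + 1 + k * Λ.Wr := Λ.off_zero k
      have a5 : Λ.off (k + 1) 0 = Λ.H + 1 + (k + 1) * Λ.Wr := Λ.off_zero (k + 1)
      have hk' := hKWr hk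
      refine conjF_apply ?_ (conjF_apply ?_ (conjF_apply ?_ (conjF_apply ?_ ?_)))
      · rw [vecEqLeaf_apply (nthF0_rec4 _ _ _ _) (bAffF_rec4 _ _ _ _ _ _) (aAffF_rec4 _ _ _ _ _ _) (affF_rec4 _ _ _ _ _ _)
          (by nlinarith), beforeEqB]
        congr 2 <;> simp [hH]
      · rw [vecEqLeaf_apply (nthF0_rec4 _ _ _ _) (bAffF_rec4 _ _ _ _ _ _) (aAffF_rec4 _ _ _ _ _ _) (wrSubF_rec4 _ _ _ _ _)
          (by omega)]
        congr 2 <;> omega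
      · rw [vecConstLeaf_apply _ (bAffSubF_rec4 _ _ _ _ _ _ _), ← hWc]
        congr 2
        omega
      · rw [vecEqLeaf_apply (nthF0_rec4 _ _ _ _) (bAffF_rec4 _ _ _ _ _ _) (aAffF_rec4 _ _ _ _ _ _) (affF_rec4 _ _ _ _ _ _)
          (by nlinarith), afterEqB, a5]
        congr 2 <;> simp [hH]
      · rw [hWc]
        refine bigConjF_map_apply fun v hv => ?_
        rw [List.mem_range] at hv
        rw [impFh_apply (varLeaf_apply (aAffF_rec4 _ _ _ _ _ _)) (hpc _)]
        congr 3
        omega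
    · rw [if_neg hk, if_neg hk]
      exact conjF_apply (hpc _) hall

/-- Value of the emitter at a counter value. [folklore] -/
theorem caseAtEmit_apply (p : ℕ) : caseAtEmit P Λ.K Λ.N p (rec4 pad a b Λ.Wr) = (caseAtB Λ P a b p).code := by
  cases hP : P[p]? with
  | some i =>
    simp only [caseAtEmit, caseAtB, hP]
    exact caseInstrEmit_apply hH hcap pad a b hpad i
  | none =>
    have hNc : Λ.Nc = Λ.H + 1 + Λ.K * Λ.Wr := rfl
    simp only [caseAtEmit, caseAtB, hP]
    rw [vecEqLeaf_apply (nthF0_rec4 _ _ _ _) (nthF2_rec4 _ _ _ _) (nthF1_rec4 _ _ _ _) (affF_rec4 _ _ _ _ _ _) (by omega)]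
    congr 2
    rw [Lay.Nc, hH]

/-- **Value of the step emitter: the code of the based step formula.**
[cite: AroraBarakCC2009, Thm. 4.13 (proof: "we show how to construct … in polynomial time")] -/
theorem stepEmit_apply : stepEmit P Λ.K Λ.N (rec4 pad a b Λ.Wr) = (stepTplB Λ P a b).code := by
  rw [stepEmit, stepTplB, hH]
  refine bigConjF_map_apply fun p hp => ?_
  rw [impFh_apply (varLeaf_apply (aAffF_rec4 _ _ _ _ _ _)) (caseAtEmit_apply hH hcap pad a b hpad p)]
  congr 3
  simp

end StepEmitApply

/-! ### The acceptance emitter -/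

section AccEmit

variable (K N : ℕ) (Hs k₁ acc : ℕ)

/-- **The emitter of the based acceptance formula** `accTplB Λ k₁ acc a` on the record
`⟨pad, ⟨bin a, ⟨bin b, bin Wr⟩⟩⟩` (`Hs = H + 1`; layout with at least two cells). [cite: AroraBarakCC2009, Thm. 4.13 (proof)] -/
def accEmit : List Bool → List Bool :=
  if k₁ < K then conjF (vecConstLeaf (onehot (N + 2) (acc + 1)) (aAffF Hs k₁)) (vecConstLeaf (onehot (N + 2) 0) (aAffF (Hs + (N + 2)) k₁))
  else fun _ => [false, true, false]

/-- `accEmit … ∈ FP`. [folklore] -/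
theorem accEmit_mem_FP : accEmit K N Hs k₁ acc ∈ FP := by
  unfold accEmit
  split
  · exact conjF_mem_FP (vecConstLeaf_mem_FP _ (aAffF_mem_FP _ _)) (vecConstLeaf_mem_FP _ (aAffF_mem_FP _ _))
  · exact const_mem_FP _

variable {K N k₁ acc}

/-- **Value of the acceptance emitter.** [folklore] -/
theorem accEmit_apply {Λ : Lay} (hcap : 2 ≤ Λ.cap) (pad : List Bool) (a b : ℕ) :
    accEmit Λ.K Λ.N (Λ.H + 1) k₁ acc (rec4 pad a b Λ.Wr) = (accTplB Λ k₁ acc a).code := by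
  have hWc : Λ.Wc = Λ.N + 2 := rfl
  unfold accEmit accTplB
  by_cases hk : k₁ < Λ.K
  · rw [if_pos hk, if_pos ⟨hk, hcap⟩]
    refine conjF_apply ?_ ?_
    · rw [vecConstLeaf_apply _ (aAffF_rec4 _ _ _ _ _ _), Lay.off_zero, hWc]
    · rw [vecConstLeaf_apply _ (aAffF_rec4 _ _ _ _ _ _), Lay.off_succ, Lay.off_zero, hWc]
      congr 3
      ring
  · rw [if_neg hk, if_neg (fun h => hk h.1)]
    rfl

end AccEmit

end TQBFRed

end Literature.Barriers.QuantumAdvantage
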